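import Mathlib.Topology.Maps.Basic
import Mathlib.Topology.ContinuousOn
import Mathlib.Topology.Constructions
import HarnessLib

/-!
# Gluing toolbox for the gap certificate, III: open embeddings of restrictions
# (crux `StarvedNecks.NeckGapDecay`, stmt-FinalStateConjecture-16768, line `Sketch`, packaging stub P-glue `stub_certOfCoreFrom`)

Elementary point-set topology of the belt construction: a map which is continuous and injective on an open set
`U` and sends open subsets of `U` to open sets restricts to an open embedding of `U`
(`isOpenEmbedding_restrict_of_forall_isOpen_image`), and conversely an open embedding of `A` sends open
subsets of `A` to open sets and is injective on `A`.  (Engelking, *General Topology*, §2.1; Mathlib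
`Topology.IsOpenEmbedding.of_continuous_injective_isOpenMap`.)  No new definitions.
-/

open Set Function Topology

namespace Summit.FinalStateConjecture.FinalStateConjecture.Theorems.NeckGapDecay.ConnectionLevelCones.Glue

set_option linter.dupNamespace false

/-- An open embedding of `A` maps open subsets of `A` (open in the ambient space) to open sets. [folklore] -/
theorem isOpen_image_of_isOpenEmbedding_restrict {X Y : Type*} [TopologicalSpace X] [TopologicalSpace Y]
    {f : X → Y} {A V : Set X}
    (h : IsOpenEmbedding (A.restrict f)) (hV : IsOpen V) (hVA : V ⊆ A) : IsOpen (f '' V) := by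
  have h1 : f '' V = A.restrict f '' (Subtype.val ⁻¹' V) := by
    ext y
    constructor
    · rintro ⟨x, hx, rfl⟩
      exact ⟨⟨x, hVA hx⟩, hx, rfl⟩
    · rintro ⟨⟨x, hxA⟩, hx, rfl⟩
      exact ⟨x, hx, rfl⟩
  rw [h1]
  exact h.isOpenMap _ (hV.preimage continuous_subtype_val)

/-- An open embedding of `A` is injective on `A`. [folklore] -/
theorem injOn_of_isOpenEmbedding_restrict {X Y : Type*} [TopologicalSpace X] [TopologicalSpace Y]
    {f : X → Y} {A : Set X} (h : IsOpenEmbedding (A.restrict f)) : InjOn f A := by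
  intro x hx y hy hxy
  have := h.injective (a₁ := ⟨x, hx⟩) (a₂ := ⟨y, hy⟩) hxy
  exact congrArg Subtype.val this

/-- **Open embedding of a restriction from pointwise data.**  If `U` is open, `f` is continuous and injective on
`U`, and `f` maps open subsets of `U` to open sets, then `U.restrict f` is an open embedding. [folklore] -/
theorem isOpenEmbedding_restrict_of_forall_isOpen_image {X Y : Type*} [TopologicalSpace X]
    [TopologicalSpace Y] {f : X → Y} {U : Set X} (hU : IsOpen U) (hc : ContinuousOn f U) (hinj : Set.InjOn f U)
    (hopen : ∀ V : Set X, IsOpen V → V ⊆ U → IsOpen (f '' V)) : Topology.IsOpenEmbedding (U.restrict f) := by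
  refine IsOpenEmbedding.of_continuous_injective_isOpenMap (continuousOn_iff_continuous_restrict.1 hc)
    (injOn_iff_injective.1 hinj) fun W hW ↦ ?_
  obtain ⟨V, hV, rfl⟩ := isOpen_induced_iff.1 hW
  have h1 : U.restrict f '' (Subtype.val ⁻¹' V) = f '' (V ∩ U) := by
    ext y
    constructor
    · rintro ⟨⟨x, hxU⟩, hx, rfl⟩
      exact ⟨x, ⟨hx, hxU⟩, rfl⟩
    · rintro ⟨x, ⟨hxV, hxU⟩, rfl⟩
      exact ⟨⟨x, hxU⟩, hxV, rfl⟩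
  rw [h1]
  exact hopen _ (hV.inter hU) inter_subset_right

/-- The image of a union of two sets under a map defined by cases agrees with the union of the images of the
pieces under the two branch maps, when each branch map agrees with the map on its piece. [folklore] -/
theorem image_eq_union_of_eqOn {X Y : Type*} {f g₁ g₂ : X → Y} {V V₁ V₂ : Set X} (hV : V ⊆ V₁ ∪ V₂)
    (h₁ : EqOn f g₁ V₁) (h₂ : EqOn f g₂ V₂) :
    f '' V = g₁ '' (V ∩ V₁) ∪ g₂ '' (V ∩ V₂) := by
  ext y
  constructor
  · rintro ⟨x, hx, rfl⟩
    rcases hV hx with h | h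
    · exact Or.inl ⟨x, ⟨hx, h⟩, (h₁ h).symm⟩
    · exact Or.inr ⟨x, ⟨hx, h⟩, (h₂ h).symm⟩
  · rintro (⟨x, ⟨hx, hx1⟩, rfl⟩ | ⟨x, ⟨hx, hx2⟩, rfl⟩)
    · exact ⟨x, hx, h₁ hx1⟩
    · exact ⟨x, hx, h₂ hx2⟩

end Summit.FinalStateConjecture.FinalStateConjecture.Theorems.NeckGapDecay.ConnectionLevelCones.Glue
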